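import Literature.NumberTheory.Automorphic.BorelBruhatCellsGK
import Literature.NumberTheory.Automorphic.OpenBruhatCellGL
import Literature.NumberTheory.Automorphic.U3LocalBruhatDecomposition   -- ★ typ-T3a: the NAMED FACT `U3LocalBruhatDecomposition L` (discharged in §4)
import Literature.NumberTheory.Automorphic.UnitaryGroupNonsplitPlace        -- ★ `LocalRing.isField_of_smul_eq` (one place above a non-split `v`)
import HarnessLib

/-!
# The Bruhat decomposition of the quasi-split unitary group `U(Φ_n)(E)`: `U(Φ₃) = B ⊔ B w₀ N` — PROOFS, and the named fact
# ★ `U3LocalBruhatDecomposition L` DISCHARGED (`U3LocalBruhatDecomposition_holds`)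

Topic `NumberTheory/Automorphic`; namespace `Literature.NumberTheory.Automorphic.UnitaryGroup` (continues ★
`UnitaryGroupBorelInduction`).  Theorems, plus two definitions WITH BODIES (`qsInvolution`, `weylLongU`) and private `[folklore]`
plumbing (incl. a private copy `transposeInvGL` of the tree's transpose-inverse ★ `glTransposeInv`); no named fact, no
`sorry`, no instance, no notation.

Setting.  `K` a field, `σ : K →+* K` ANY ring endomorphism (for Rogawski's `U(3)`: `K = E` a quadratic extension of
`F` with `σ` its conjugation; no hypothesis on `σ` is used), `J₀ = Φ_n = antidiag(1, …, 1)` (★ `StdForm.antidiagonal`,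
= the long Weyl element `w⁰ = weylLong n K` as a matrix, `antidiagonal_over_eq_coe_weylLong`), and
`U = U(σ, J₀)(K) = {g ∈ GL_n(K) : ᵗ(σg) J₀ g = J₀}` (★ `unitaryGroupOfForm`), with its upper-triangular Borel
`B_U = borelU σ J₀`, unipotent radical `N_U = unipotentU σ J₀` (★ `UnitaryGroupBorelInduction`) [Rogawski1990, §1.10
p. 9: «`B` will denote the Borel subgroup of upper-triangular matrices, `N` … its unipotent radical»].

Results.
* §1 **The quasi-split involution** `Θ_σ(g) = w⁰ · ᵗ(σ g)⁻¹ · w⁰` of `GL_n(K)` (`qsInvolution σ`): a group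
  endomorphism (`qsInvolution_mul`) whose FIXED POINTS are exactly `U(σ, J₀)`
  (`mem_unitaryGroupOfForm_iff_qsInvolution_eq`); it is `(ι(σ g))⁻¹` for the tree's Gelfand–Kazhdan
  anti-involution `ι(g) = w⁰ ᵗg w⁰` (`qsInvolution_eq_gkInvolution_inv`), hence preserves the upper-triangular
  group `B` and the unitriangular group `U_n` and sends the permutation matrix `P_τ` to `P_{rev τ rev}`
  (`qsInvolution_permGL`); consequently **`Θ_σ(B P_τ U_n) ⊆ B P_{rev τ rev} U_n`** (`qsInvolution_mem_bruhatCell`).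
* §2 **Which `GL_n`-Bruhat cells meet `U`**: if `g ∈ U ∩ B P_τ U_n` then `rev τ rev = τ`
  (`revPerm_mul_mul_revPerm_eq_of_mem`) — the cells are disjoint (★ `disjoint_bruhatCell`) and `g = Θ_σ g` lies in
  the cell of `rev τ rev`.  On the big cell `B w₀ U_n` the ★ unique normal form `g = p w₀ n′` (★
  `eq_of_parabolic_mul_w₀_mul_eq`, with `oppositeCellRadical id = U_n`, `oppositeCellRadical_id_eq`) is `Θ_σ`-stable
  term by term (`Θ_σ w₀ = w₀`), so `p, n′ ∈ U` (`exists_borel_unipotent_of_mem_bigCell`).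
* §3 **`n = 3`** [Rogawski1990, §1.10; Casselman1995, Prop. 1.3.1 for the Tits system of a quasi-split group of
  relative rank one; BorelTits1965, §5]: a permutation of `Fin 3` commuting with `rev` is `1` or `rev`
  (`perm_fin_three_eq_one_or_eq_revPerm`), whence **`U(σ, Φ₃)(K) = B_U ⊔ B_U · w₀ · N_U`**
  (`mem_borelU_or_exists_eq_mul_weylLongU_mul`, with `w₀ ∈ U` as `weylLongU`), the two pieces DISJOINT
  (`mul_weylLongU_mul_not_mem_borelU`) and the big-cell coordinates `(b, u) ∈ B_U × N_U` UNIQUE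
  (`eq_of_mul_weylLongU_mul_eq`); all three stated, as in ★ `UnitaryGroupBorelInduction`, for any `J` with
  `hJ : J = (StdForm.antidiagonal 3).over K`.
* §4 **The CM instance**: at a NON-SPLIT finite place `v` of `L⁺` the semi-local ring `L ⊗ L⁺_v = ∏_{w ∣ v} L_w`
  (★ `LocalRing L v`) is a field (★ `LocalRing.isField_of_smul_eq`), so §3 applies to `σ = c ⊗ 1` (★ `conjLocal`) and
  `J = cmLocalForm L 3 v = Φ₃` (★ `cmLocalForm_eq_over`): **`U3LocalBruhatDecomposition_holds : U3LocalBruhatDecomposition L`**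
  — typ-T3a's named fact ★ `Literature/NumberTheory/Automorphic/U3LocalBruhatDecomposition.lean` (the hypothesis of the
  in-house Jacquet-filtration node N1 ★ `U3PrincipalSeriesJacquetFiltration`) is now a THEOREM.

This is node F1 of the cell's `T3b-TREE` (topic T3, Keys `KeysCaseTwo` pay-down): the two `(B, B)`-double cosets of
`U(3)` are the starting point of the geometric lemma for the Jacquet module of the principal series
`i_G(χ)` ([Casselman1995, §6.3]; tree node N1) and of the open-cell model of the intertwining operator `T_w`.

## References

* J. D. Rogawski, *Automorphic Representations of Unitary Groups in Three Variables*, Annals of Math. Studies 123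
  (1990), §1.10 p. 9 [Rogawski1990].
* W. Casselman, *Introduction to the theory of admissible representations of p-adic reductive groups* (1995),
  Prop. 1.3.1, §6.3 [Casselman1995].
* A. Borel, J. Tits, *Groupes réductifs*, Publ. Math. IHÉS 27 (1965), §5 (Thm. 5.15) [BorelTits1965].
* D. Bump, *Automorphic Forms and Representations* (1997), §4.4 p. 455 (the involution `g ↦ w⁰ ᵗg w⁰`) [Bump1997].
-/

set_option autoImplicit false

open Matrix

namespace Literature.NumberTheory.Automorphic

namespace UnitaryGroup

/-! ## §1 The quasi-split involution `Θ_σ(g) = w⁰ ᵗ(σg)⁻¹ w⁰` of `GL_n(K)` -/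

section Involution

variable {K : Type*} [Field K] (σ : K →+* K) {n : ℕ}

/-- PRIVATE copy of the tree's transpose-inverse `g ↦ ᵗg⁻¹` on `GL_n` — the public survivors are
★ `Literature.NumberTheory.Automorphic.glTransposeInv` (`MirabolicEisensteinResidueBound`, same construction over any
commutative ring; not imported here to keep this file's closure light), ★ `Literature.NumberTheory.Automorphic.transposeInvHom`
(`DualParabolic`) and ★ `GaloisRepresentations.glTransposeInv` (topological packaging); no fourth public name is added. [folklore] -/
private def transposeInvGL (g : GL (Fin n) K) : GL (Fin n) K where
  val := ((g⁻¹ : GL (Fin n) K) : Matrix (Fin n) (Fin n) K)ᵀ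
  inv := ((g : GL (Fin n) K) : Matrix (Fin n) (Fin n) K)ᵀ
  val_inv := by
    rw [← Matrix.transpose_mul, ← Units.val_mul, mul_inv_cancel, Units.val_one, Matrix.transpose_one]
  inv_val := by
    rw [← Matrix.transpose_mul, ← Units.val_mul, inv_mul_cancel, Units.val_one, Matrix.transpose_one]

/-- The matrix of `transposeInvGL g` is `ᵗ(g⁻¹)` (= ★ `coe_glTransposeInv`). [folklore] -/
private theorem coe_transposeInvGL (g : GL (Fin n) K) :
    ((transposeInvGL g : GL (Fin n) K) : Matrix (Fin n) (Fin n) K) = ((g⁻¹ : GL (Fin n) K) : Matrix (Fin n) (Fin n) K)ᵀ :=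
  rfl

/-- The matrix of `(transposeInvGL g)⁻¹` is `ᵗg`. [folklore] -/
private theorem coe_transposeInvGL_inv (g : GL (Fin n) K) :
    (((transposeInvGL g)⁻¹ : GL (Fin n) K) : Matrix (Fin n) (Fin n) K) = ((g : GL (Fin n) K) : Matrix (Fin n) (Fin n) K)ᵀ :=
  rfl

/-- **The quasi-split involution** `Θ_σ(g) = w⁰ · ᵗ(σ g)⁻¹ · w⁰` of `GL_n(K)` (`w⁰ = weylLong n K` the antidiagonal
permutation matrix, `σ` applied entrywise): the automorphism whose fixed points are the quasi-split unitary group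
`U(σ, w⁰)` [Rogawski1990, §1.9–§1.10]. [cite: Rogawski1990, §1.9–§1.10 pp. 8–9] -/
def qsInvolution (g : GL (Fin n) K) : GL (Fin n) K :=
  weylLong n K * transposeInvGL (Matrix.GeneralLinearGroup.map σ g) * weylLong n K

/-- The matrix of `σ g` is `σ` applied entrywise. [folklore] -/
private theorem coe_map_eq (g : GL (Fin n) K) :
    ((Matrix.GeneralLinearGroup.map σ g : GL (Fin n) K) : Matrix (Fin n) (Fin n) K) =
      ((g : GL (Fin n) K) : Matrix (Fin n) (Fin n) K).map σ :=
  rfl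

/-- The matrix of `Θ_σ(g)`: `w⁰ · ᵗ((σ g)⁻¹) · w⁰`. [cite: Rogawski1990, §1.9 p. 8] -/
theorem coe_qsInvolution (g : GL (Fin n) K) :
    ((qsInvolution σ g : GL (Fin n) K) : Matrix (Fin n) (Fin n) K) =
      ((weylLong n K : GL (Fin n) K) : Matrix (Fin n) (Fin n) K) *
        ((((g : GL (Fin n) K) : Matrix (Fin n) (Fin n) K).map σ)⁻¹)ᵀ * ((weylLong n K : GL (Fin n) K) : Matrix (Fin n) (Fin n) K) := by
  rw [qsInvolution, Units.val_mul, Units.val_mul, coe_transposeInvGL, Matrix.coe_units_inv, coe_map_eq]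

/-- `Θ_σ = (ι ∘ σ)⁻¹` for the tree's Gelfand–Kazhdan anti-involution `ι(g) = w⁰ ᵗg w⁰` (★ `gkInvolution`, which
carries a topology on `K` in its packaging; any topology will do). [cite: Bump1997, §4.4 p. 455] -/
theorem qsInvolution_eq_gkInvolution_inv [TopologicalSpace K] (g : GL (Fin n) K) :
    qsInvolution σ g = (gkInvolution (Matrix.GeneralLinearGroup.map σ g))⁻¹ := by
  rw [← gkInvolution_inv, gkInvolution_inv_eq, qsInvolution]
  congr 1

/-- `Θ_σ` is multiplicative (an automorphism of `GL_n(K)`; `ι` is an anti-automorphism). [cite: Rogawski1990, §1.9 p. 8]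
[cite: Bump1997, §4.4 p. 455] -/
theorem qsInvolution_mul (g h : GL (Fin n) K) :
    qsInvolution σ (g * h) = qsInvolution σ g * qsInvolution σ h := by
  letI : TopologicalSpace K := ⊥
  rw [qsInvolution_eq_gkInvolution_inv, qsInvolution_eq_gkInvolution_inv, qsInvolution_eq_gkInvolution_inv,
    map_mul, gkInvolution_mul, _root_.mul_inv_rev]

/-- `σ` applied entrywise preserves the upper-triangular group `B = P_id`. [folklore] -/
private theorem map_mem_borel {b : GL (Fin n) K} (hb : b ∈ standardParabolicGL K (_root_.id : Fin n → Fin n)) :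
    Matrix.GeneralLinearGroup.map σ b ∈ standardParabolicGL K (_root_.id : Fin n → Fin n) := by
  intro i j hij
  rw [coe_map_eq, Matrix.map_apply, hb hij, map_zero]

/-- `σ` applied entrywise preserves the unitriangular group `U_n`. [folklore] -/
private theorem map_mem_upperUnitriangular {u : GL (Fin n) K} (hu : u ∈ upperUnitriangular (Fin n) K) :
    Matrix.GeneralLinearGroup.map σ u ∈ upperUnitriangular (Fin n) K := by
  rw [mem_upperUnitriangular_iff] at hu ⊢
  refine ⟨fun i j hij => ?_, fun i => ?_⟩
  · rw [coe_map_eq, Matrix.map_apply, hu.1 hij, map_zero]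
  · rw [coe_map_eq, Matrix.map_apply, hu.2 i, map_one]

/-- `σ` applied entrywise fixes every permutation matrix. [folklore] -/
private theorem map_permGL (τ : Equiv.Perm (Fin n)) :
    Matrix.GeneralLinearGroup.map σ (permGL τ : GL (Fin n) K) = permGL τ := by
  apply Units.ext
  ext i j
  rw [coe_map_eq, Matrix.map_apply, coe_permGL, permMatrix_apply']
  split_ifs
  · exact map_one σ
  · exact map_zero σ

/-- `(P_τ)⁻¹ = P_{τ⁻¹}` in `GL_n`. [folklore] -/
private theorem permGL_inv (τ : Equiv.Perm (Fin n)) : ((permGL τ : GL (Fin n) K))⁻¹ = permGL τ⁻¹ := by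
  refine inv_eq_of_mul_eq_one_right (Units.ext ?_)
  rw [Units.val_mul, coe_permGL, coe_permGL, ← Matrix.permMatrix_mul, inv_mul_cancel, Matrix.permMatrix_one,
    Units.val_one]

/-- **`Θ_σ(B) ⊆ B`** (`ι` preserves `B`, ★ `gkInvolution_mem_borel`). [cite: Bump1997, §4.4 p. 455] [cite: Rogawski1990, §1.9–§1.10 pp. 8–9] -/
theorem qsInvolution_mem_borel {b : GL (Fin n) K} (hb : b ∈ standardParabolicGL K (_root_.id : Fin n → Fin n)) :
    qsInvolution σ b ∈ standardParabolicGL K (_root_.id : Fin n → Fin n) := by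
  letI : TopologicalSpace K := ⊥
  rw [qsInvolution_eq_gkInvolution_inv]
  exact Subgroup.inv_mem _ (gkInvolution_mem_borel (map_mem_borel σ hb))

/-- **`Θ_σ(U_n) ⊆ U_n`** (`ι` preserves `U_n`, ★ `gkInvolution_mem_upperUnitriangular`). [cite: Bump1997, §4.4 p. 455]
[cite: Rogawski1990, §1.9–§1.10 pp. 8–9] -/
theorem qsInvolution_mem_upperUnitriangular {u : GL (Fin n) K} (hu : u ∈ upperUnitriangular (Fin n) K) :
    qsInvolution σ u ∈ upperUnitriangular (Fin n) K := by
  letI : TopologicalSpace K := ⊥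
  rw [qsInvolution_eq_gkInvolution_inv]
  exact Subgroup.inv_mem _ (gkInvolution_mem_upperUnitriangular (map_mem_upperUnitriangular σ hu))

/-- **`Θ_σ(P_τ) = P_{rev τ rev}`** (`ι(P_τ) = P_{rev τ⁻¹ rev}`, ★ `gkInvolution_permGL`): the action of the quasi-split outer
automorphism on the Weyl group `S_n` is conjugation by the longest element. [cite: Rogawski1990, §1.9–§1.10 pp. 8–9]
[cite: BorelTits1965, §5 Thm. 5.15] -/
theorem qsInvolution_permGL (τ : Equiv.Perm (Fin n)) :
    qsInvolution σ (permGL τ : GL (Fin n) K) = permGL (Fin.revPerm * τ * Fin.revPerm) := by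
  letI : TopologicalSpace K := ⊥
  rw [qsInvolution_eq_gkInvolution_inv, map_permGL, gkInvolution_permGL, permGL_inv, starPerm]
  congr 1

/-- `Θ_σ(w⁰) = w⁰`: the longest Weyl element is fixed by the quasi-split automorphism. [cite: Rogawski1990, §1.10 p. 9] -/
theorem qsInvolution_weylLong : qsInvolution σ (weylLong n K) = weylLong n K := by
  rw [weylLong_eq_permGL, qsInvolution_permGL]
  congr 1
  ext i
  simp

/-- **`Θ_σ` maps the Bruhat cell `B P_τ U_n` into the cell `B P_{rev τ rev} U_n`** (it preserves `B`, `U_n` and permutes the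
Weyl representatives). [cite: BorelTits1965, §5 Thm. 5.15] [cite: Rogawski1990, §1.9–§1.10 pp. 8–9] -/
theorem qsInvolution_mem_bruhatCell {τ : Equiv.Perm (Fin n)} {g : GL (Fin n) K} (hg : g ∈ bruhatCell (K := K) τ) :
    qsInvolution σ g ∈ bruhatCell (K := K) (Fin.revPerm * τ * Fin.revPerm) := by
  obtain ⟨b, hb, u, hu, rfl⟩ := hg
  rw [qsInvolution_mul, qsInvolution_mul, qsInvolution_permGL]
  exact ⟨qsInvolution σ b, qsInvolution_mem_borel σ hb, qsInvolution σ u, qsInvolution_mem_upperUnitriangular σ hu,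
    rfl⟩

/-- **`U(σ, w⁰) = Fix(Θ_σ)`**: `g ∈ U(σ, J₀)` for the antidiagonal form `J₀ = w⁰` iff `Θ_σ g = g`
(`ᵗ(σg) w⁰ g = w⁰ ⇔ g = w⁰ ᵗ(σg)⁻¹ w⁰`, as `(w⁰)² = 1`). [cite: Rogawski1990, §1.9–§1.10 pp. 8–9] -/
theorem mem_unitaryGroupOfForm_iff_qsInvolution_eq (g : GL (Fin n) K) :
    g ∈ unitaryGroupOfForm σ ((weylLong n K : GL (Fin n) K) : Matrix (Fin n) (Fin n) K) ↔ qsInvolution σ g = g := by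
  have key : g ∈ unitaryGroupOfForm σ ((weylLong n K : GL (Fin n) K) : Matrix (Fin n) (Fin n) K) ↔
      (transposeInvGL (Matrix.GeneralLinearGroup.map σ g))⁻¹ * weylLong n K * g = weylLong n K := by
    rw [mem_unitaryGroupOfForm_iff, ← Units.val_inj, Units.val_mul, Units.val_mul, coe_transposeInvGL_inv, coe_map_eq]
  rw [key, qsInvolution]
  constructor
  · intro h
    calc weylLong n K * transposeInvGL (Matrix.GeneralLinearGroup.map σ g) * weylLong n K
        = weylLong n K * transposeInvGL (Matrix.GeneralLinearGroup.map σ g) *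
            ((transposeInvGL (Matrix.GeneralLinearGroup.map σ g))⁻¹ * weylLong n K * g) := by rw [h]
      _ = g := by rw [← mul_assoc, ← mul_assoc, mul_inv_cancel_right, weylLong_mul_self, one_mul]
  · intro h
    calc (transposeInvGL (Matrix.GeneralLinearGroup.map σ g))⁻¹ * weylLong n K * g
        = (transposeInvGL (Matrix.GeneralLinearGroup.map σ g))⁻¹ * weylLong n K *
            (weylLong n K * transposeInvGL (Matrix.GeneralLinearGroup.map σ g) * weylLong n K) := by rw [h]
      _ = weylLong n K := by
          rw [show (transposeInvGL (Matrix.GeneralLinearGroup.map σ g))⁻¹ * weylLong n K *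
              (weylLong n K * transposeInvGL (Matrix.GeneralLinearGroup.map σ g) * weylLong n K) =
              (transposeInvGL (Matrix.GeneralLinearGroup.map σ g))⁻¹ * (weylLong n K * weylLong n K) *
                transposeInvGL (Matrix.GeneralLinearGroup.map σ g) * weylLong n K by group,
            weylLong_mul_self, mul_one, inv_mul_cancel, one_mul]

end Involution

/-! ## §2 Which Bruhat cells of `GL_n` meet `U(σ, J₀)`; the big-cell coordinates lie in `U` -/

section Cells

variable {K : Type*} [Field K] (σ : K →+* K) {n : ℕ}

/-- **A Bruhat cell `B P_τ U_n` of `GL_n(K)` meets `U(σ, J₀)` only if `rev ∘ τ ∘ rev = τ`** (`τ` commutes with the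
longest element): `g = Θ_σ g` lies in the cells of `τ` and of `rev τ rev`, which are disjoint unless equal
(★ `disjoint_bruhatCell`, ★ `eq_of_bruhatCell_eq`). [cite: BorelTits1965, §5 Thm. 5.15] [cite: Casselman1995, Prop. 1.3.1] -/
theorem revPerm_mul_mul_revPerm_eq_of_mem {τ : Equiv.Perm (Fin n)} {g : GL (Fin n) K}
    (hU : g ∈ unitaryGroupOfForm σ ((weylLong n K : GL (Fin n) K) : Matrix (Fin n) (Fin n) K))
    (hg : g ∈ bruhatCell (K := K) τ) : Fin.revPerm * τ * Fin.revPerm = τ := by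
  have h1 := qsInvolution_mem_bruhatCell σ hg
  rw [(mem_unitaryGroupOfForm_iff_qsInvolution_eq σ g).1 hU] at h1
  by_contra hne
  exact Set.disjoint_left.1 (disjoint_bruhatCell (K := K) hne) h1 hg

/-- For the trivial block labelling the «opposite cell radical» `N′` of ★ `OpenBruhatCellGL` is all of `U_n`
(every block is a singleton). [folklore] -/
private theorem oppositeCellRadical_id_eq :
    oppositeCellRadical (K := K) (_root_.id : Fin n → Fin n) = upperUnitriangular (Fin n) K := by
  ext g
  rw [oppositeCellRadical, mem_unipotentRadicalGL_iff, mem_upperUnitriangular_iff]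
  have hbt : ((g : GL (Fin n) K) : Matrix (Fin n) (Fin n) K).BlockTriangular (⇑OrderDual.toDual ∘ revLabel _root_.id) ↔
      ((g : GL (Fin n) K) : Matrix (Fin n) (Fin n) K).BlockTriangular (_root_.id : Fin n → Fin n) := by
    constructor
    · intro h i j hij
      exact h (by
        change OrderDual.toDual (Fin.rev j) < OrderDual.toDual (Fin.rev i)
        exact OrderDual.toDual_lt_toDual.2 (Fin.rev_lt_rev.2 hij))
    · intro h i j hij
      refine h ?_
      have : OrderDual.toDual (Fin.rev j) < OrderDual.toDual (Fin.rev i) := hij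
      exact Fin.rev_lt_rev.1 (OrderDual.toDual_lt_toDual.1 this)
  rw [hbt]
  refine and_congr_right fun _ => ⟨fun h i => ?_, fun h a => ?_⟩
  · have := congrFun (congrFun (h (OrderDual.toDual (Fin.rev i))) ⟨i, rfl⟩) ⟨i, rfl⟩
    rwa [Matrix.toSquareBlock_def, Matrix.one_apply_eq] at this
  · ext ⟨i, hi⟩ ⟨j, hj⟩
    have hij : i = j := by
      have h1 : OrderDual.toDual (Fin.rev i) = OrderDual.toDual (Fin.rev j) := hi.trans hj.symm
      exact Fin.rev_injective (OrderDual.toDual.injective h1)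
    subst hij
    rw [Matrix.toSquareBlock_def, Matrix.one_apply_eq]
    exact h i

/-- **Uniqueness of the big-cell coordinates** `b w⁰ u = b′ w⁰ u′ ⇒ b = b′ ∧ u = u′` (`b, b′ ∈ B`, `u, u′ ∈ U_n`;
`B ∩ w⁰ U_n w⁰ = 1`), ★ `eq_of_parabolic_mul_w₀_mul_eq` for the Borel. [cite: BorelTits1965, §5 Thm. 5.15]
[cite: Casselman1995, Prop. 1.3.1] -/
theorem eq_of_borel_mul_weylLong_mul_eq {b b' u u' : GL (Fin n) K}
    (hb : b ∈ standardParabolicGL K (_root_.id : Fin n → Fin n)) (hb' : b' ∈ standardParabolicGL K (_root_.id : Fin n → Fin n))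
    (hu : u ∈ upperUnitriangular (Fin n) K) (hu' : u' ∈ upperUnitriangular (Fin n) K)
    (h : b * weylLong n K * u = b' * weylLong n K * u') : b = b' ∧ u = u' := by
  rw [weylLong_eq_permGL] at h
  rw [← oppositeCellRadical_id_eq] at hu hu'
  exact eq_of_parabolic_mul_w₀_mul_eq _root_.id hb hb' hu hu' h

/-- **The big-cell coordinates of an element of `U` lie in `U`**: if `g ∈ U(σ, J₀)` lies in `B w⁰ U_n`, then
`g = b w⁰ u` with `b ∈ B ∩ U` and `u ∈ U_n ∩ U` — apply `Θ_σ` to the unique normal form (`Θ_σ w⁰ = w⁰`).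
[cite: BorelTits1965, §5 Thm. 5.15] [cite: Rogawski1990, §1.10 p. 9] -/
theorem exists_borel_unipotent_of_mem_bigCell {g : GL (Fin n) K}
    (hU : g ∈ unitaryGroupOfForm σ ((weylLong n K : GL (Fin n) K) : Matrix (Fin n) (Fin n) K))
    (hg : g ∈ bruhatCell (K := K) Fin.revPerm) :
    ∃ b u : GL (Fin n) K, b ∈ standardParabolicGL K (_root_.id : Fin n → Fin n) ∧
      b ∈ unitaryGroupOfForm σ ((weylLong n K : GL (Fin n) K) : Matrix (Fin n) (Fin n) K) ∧
      u ∈ upperUnitriangular (Fin n) K ∧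
      u ∈ unitaryGroupOfForm σ ((weylLong n K : GL (Fin n) K) : Matrix (Fin n) (Fin n) K) ∧
      g = b * weylLong n K * u := by
  obtain ⟨b, hb, u, hu, rfl⟩ := hg
  rw [← weylLong_eq_permGL] at hU ⊢
  have hfix := (mem_unitaryGroupOfForm_iff_qsInvolution_eq σ _).1 hU
  rw [qsInvolution_mul, qsInvolution_mul, qsInvolution_weylLong] at hfix
  obtain ⟨hbb, huu⟩ := eq_of_borel_mul_weylLong_mul_eq (qsInvolution_mem_borel σ hb) hb
    (qsInvolution_mem_upperUnitriangular σ hu) hu hfix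
  exact ⟨b, u, hb, (mem_unitaryGroupOfForm_iff_qsInvolution_eq σ b).2 hbb, hu,
    (mem_unitaryGroupOfForm_iff_qsInvolution_eq σ u).2 huu, rfl⟩

end Cells

/-! ## §3 `n = 3`: `U(σ, Φ₃)(K) = B_U ⊔ B_U · w₀ · N_U` with unique big-cell coordinates -/

section Three

variable {K : Type*} [Field K] (σ : K →+* K)

/-- The permutations of `{0, 1, 2}` commuting with the order-reversing involution `rev = (0 2)` are `1` and `rev`.
[folklore] -/
private theorem perm_fin_three_eq_one_or_eq_revPerm (τ : Equiv.Perm (Fin 3)) (hτ : Fin.revPerm * τ * Fin.revPerm = τ) :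
    τ = 1 ∨ τ = Fin.revPerm := by
  revert τ
  decide

/-- `J₀ = antidiag(1, …, 1)` over `K` IS the matrix of the long Weyl element `w⁰` (the form `Φ_n` of [Rogawski1990, §1.9],
Mok's `J_N`; cf. ★ `antidiagonal_over_eq_permMatrix`). [cite: Rogawski1990, §1.9 p. 8] [cite: Mok2014, §1 Notation p. 5] -/
theorem antidiagonal_over_eq_coe_weylLong (n : ℕ) :
    (StdForm.antidiagonal n).over K = ((weylLong n K : GL (Fin n) K) : Matrix (Fin n) (Fin n) K) := by
  ext i j
  rw [coe_weylLong, permMatrix_apply', Fin.revPerm_apply, StdForm.over, Matrix.map_apply, StdForm.antidiagonal_J_apply]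
  by_cases h : j = Fin.rev i
  · rw [if_pos h, if_pos h.symm, map_one]
  · rw [if_neg h, if_neg (fun h' => h h'.symm), map_zero]

variable {n : ℕ}

/-- **`w₀ ∈ U(σ, J₀)`**: the long Weyl element preserves the antidiagonal form (`Θ_σ w⁰ = w⁰`); stated, as in ★
`UnitaryGroupBorelInduction`, for any `J` with `hJ : J = Φ_n`. [cite: Rogawski1990, §1.10 p. 9] -/
theorem weylLong_mem_unitaryGroupOfForm {J : Matrix (Fin n) (Fin n) K} (hJ : J = (StdForm.antidiagonal n).over K) :
    weylLong n K ∈ unitaryGroupOfForm σ J := by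
  rw [hJ, antidiagonal_over_eq_coe_weylLong, mem_unitaryGroupOfForm_iff_qsInvolution_eq, qsInvolution_weylLong]

/-- The long Weyl element `w₀` as an element of the subtype group `↥U(σ, J)`, `J = Φ_n`. [cite: Rogawski1990, §1.10 p. 9] -/
def weylLongU {J : Matrix (Fin n) (Fin n) K} (hJ : J = (StdForm.antidiagonal n).over K) : ↥(unitaryGroupOfForm σ J) :=
  ⟨weylLong n K, weylLong_mem_unitaryGroupOfForm σ hJ⟩

/-- The underlying invertible matrix of `weylLongU` is `w⁰`. [cite: Rogawski1990, §1.10 p. 9] -/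
theorem coe_weylLongU {J : Matrix (Fin n) (Fin n) K} (hJ : J = (StdForm.antidiagonal n).over K) :
    ((weylLongU σ hJ : ↥(unitaryGroupOfForm σ J)) : GL (Fin n) K) = weylLong n K := rfl

/-- The matrix of `weylLongU` is the form matrix `J = Φ_n` itself. [cite: Rogawski1990, §1.10 p. 9] -/
theorem coe_coe_weylLongU {J : Matrix (Fin n) (Fin n) K} (hJ : J = (StdForm.antidiagonal n).over K) :
    (((weylLongU σ hJ : ↥(unitaryGroupOfForm σ J)) : GL (Fin n) K) : Matrix (Fin n) (Fin n) K) = J := by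
  rw [coe_weylLongU, hJ, antidiagonal_over_eq_coe_weylLong]

variable {J : Matrix (Fin 3) (Fin 3) K} (hJ : J = (StdForm.antidiagonal 3).over K)
include hJ

/-- **Bruhat decomposition of `U(3)`, existence** [Rogawski1990, §1.10]: every `g ∈ U(σ, Φ₃)(K)` is upper triangular
or of the form `b · w₀ · u` with `b ∈ B_U` and `u ∈ N_U` — `G = B ⊔ B w₀ N`.
[cite: Rogawski1990, §1.10 p. 9] [cite: Casselman1995, Prop. 1.3.1] [cite: BorelTits1965, §5 Thm. 5.15] -/
theorem mem_borelU_or_exists_eq_mul_weylLongU_mul (g : ↥(unitaryGroupOfForm σ J)) :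
    g ∈ borelU σ J ∨ ∃ b ∈ borelU σ J, ∃ u ∈ unipotentU σ J, g = b * weylLongU σ hJ * u := by
  subst hJ
  have hU : (g : GL (Fin 3) K) ∈ unitaryGroupOfForm σ ((weylLong 3 K : GL (Fin 3) K) : Matrix (Fin 3) (Fin 3) K) := by
    rw [← antidiagonal_over_eq_coe_weylLong]; exact g.2
  obtain ⟨τ, hτ⟩ := exists_mem_bruhatCell (K := K) (g : GL (Fin 3) K)
  rcases perm_fin_three_eq_one_or_eq_revPerm τ (revPerm_mul_mul_revPerm_eq_of_mem σ hU hτ) with rfl | rfl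
  · -- the small cell `B · 1 · U_n = B`
    left
    obtain ⟨b, hb, u, hu, hg⟩ := hτ
    rw [mem_borelU_iff]
    have : (g : GL (Fin 3) K) ∈ standardParabolicGL K (_root_.id : Fin 3 → Fin 3) := by
      rw [hg, show (permGL (1 : Equiv.Perm (Fin 3)) : GL (Fin 3) K) = 1 from
        Units.ext (by rw [coe_permGL, Matrix.permMatrix_one, Units.val_one]), mul_one]
      exact Subgroup.mul_mem _ hb (upperUnitriangular_le_borel hu)
    exact this
  · -- the big cell
    right
    obtain ⟨b, u, hb, hbU, hu, huU, hg⟩ := exists_borel_unipotent_of_mem_bigCell σ hU hτ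
    rw [← antidiagonal_over_eq_coe_weylLong] at hbU huU
    refine ⟨⟨b, hbU⟩, hb, ⟨u, huU⟩, (mem_unipotentU_iff _).2 ((mem_upperUnitriangular_iff _).1 hu), ?_⟩
    exact Subtype.ext hg

/-- **Bruhat decomposition of `U(3)`, disjointness**: `b · w₀ · u ∉ B_U` for `b ∈ B_U`, `u ∈ N_U` (the cells of `1`
and `w₀` in `GL₃` are disjoint). [cite: Rogawski1990, §1.10 p. 9] [cite: Casselman1995, Prop. 1.3.1] -/
theorem mul_weylLongU_mul_not_mem_borelU {b u : ↥(unitaryGroupOfForm σ J)} (hb : b ∈ borelU σ J) (hu : u ∈ unipotentU σ J) :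
    b * weylLongU σ hJ * u ∉ borelU σ J := by
  subst hJ
  intro hmem
  have hmem' : ((b * weylLongU σ rfl * u : ↥(unitaryGroupOfForm σ ((StdForm.antidiagonal 3).over K))) : GL (Fin 3) K) ∈
      standardParabolicGL K (_root_.id : Fin 3 → Fin 3) := (mem_borelU_iff _).1 hmem
  have h1 : ((b * weylLongU σ rfl * u : ↥(unitaryGroupOfForm σ ((StdForm.antidiagonal 3).over K))) : GL (Fin 3) K) ∈
      bruhatCell (K := K) Fin.revPerm := by
    refine ⟨(b : GL (Fin 3) K), hb, (u : GL (Fin 3) K),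
      (mem_upperUnitriangular_iff _).2 ((mem_unipotentU_iff _).1 hu), ?_⟩
    rw [← weylLong_eq_permGL]; rfl
  have h2 : ((b * weylLongU σ rfl * u : ↥(unitaryGroupOfForm σ ((StdForm.antidiagonal 3).over K))) : GL (Fin 3) K) ∈
      bruhatCell (K := K) 1 := by
    refine ⟨((b * weylLongU σ rfl * u : ↥(unitaryGroupOfForm σ ((StdForm.antidiagonal 3).over K))) : GL (Fin 3) K),
      hmem', 1, Subgroup.one_mem _, ?_⟩
    rw [show (permGL (1 : Equiv.Perm (Fin 3)) : GL (Fin 3) K) = 1 from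
      Units.ext (by rw [coe_permGL, Matrix.permMatrix_one, Units.val_one]), mul_one, mul_one]
  have hne : (Fin.revPerm : Equiv.Perm (Fin 3)) ≠ 1 := by decide
  exact Set.disjoint_left.1 (disjoint_bruhatCell (K := K) hne) h1 h2

/-- `w₀ ∉ B_U`. [cite: Rogawski1990, §1.10 p. 9] -/
theorem weylLongU_not_mem_borelU : weylLongU σ hJ ∉ borelU σ J := by
  have h := mul_weylLongU_mul_not_mem_borelU σ hJ (Subgroup.one_mem (borelU σ J)) (Subgroup.one_mem (unipotentU σ J))
  rwa [one_mul, mul_one] at h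

/-- **Bruhat decomposition of `U(3)`, uniqueness of the big-cell coordinates**: `b w₀ u = b′ w₀ u′` with
`b, b′ ∈ B_U`, `u, u′ ∈ N_U` forces `b = b′` and `u = u′` («`B w₀ B = B w₀ N` with unique `N`-coordinate»).
[cite: Rogawski1990, §1.10 p. 9] [cite: BorelTits1965, §5 Thm. 5.15] -/
theorem eq_of_mul_weylLongU_mul_eq {b b' u u' : ↥(unitaryGroupOfForm σ J)}
    (hb : b ∈ borelU σ J) (hb' : b' ∈ borelU σ J) (hu : u ∈ unipotentU σ J) (hu' : u' ∈ unipotentU σ J)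
    (h : b * weylLongU σ hJ * u = b' * weylLongU σ hJ * u') : b = b' ∧ u = u' := by
  subst hJ
  have h' : (b : GL (Fin 3) K) * weylLong 3 K * u = (b' : GL (Fin 3) K) * weylLong 3 K * u' := by
    have := congrArg (fun x : ↥(unitaryGroupOfForm σ ((StdForm.antidiagonal 3).over K)) => (x : GL (Fin 3) K)) h
    simpa only [Subgroup.coe_mul, coe_weylLongU] using this
  obtain ⟨h1, h2⟩ := eq_of_borel_mul_weylLong_mul_eq hb hb'
    ((mem_upperUnitriangular_iff _).2 ((mem_unipotentU_iff _).1 hu))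
    ((mem_upperUnitriangular_iff _).2 ((mem_unipotentU_iff _).1 hu')) h'
  exact ⟨Subtype.ext h1, Subtype.ext h2⟩

end Three

/-! ## §4 The CM instance: the named fact ★ `U3LocalBruhatDecomposition L` DISCHARGED -/

section CM

open _root_.NumberField _root_.IsDedekindDomain

/-- **★ `U3LocalBruhatDecomposition L` holds** — the Bruhat decomposition `U(Φ₃)(L⁺_v) = B ⊔ B w₀ N` with unique big-cell
coordinates at every NON-SPLIT finite place `v` of `L⁺` (typ-T3a's named fact of record, node F1 of `T3b-TREE`): at such `v`
the semi-local ring `L ⊗ L⁺_v = ∏_{w ∣ v} L_w` is a FIELD (★ `LocalRing.isField_of_smul_eq`, one place above `v`), and §3 applies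
verbatim to `K := L ⊗ L⁺_v`, `σ := c ⊗ 1`, `J := cmLocalForm L 3 v = Φ₃` (★ `cmLocalForm_eq_over`), `w₀ := weylLongU` (matrix `Φ₃`).
[cite: Casselman1995, Prop. 1.3.1, Prop. 1.3.3] [cite: BorelTits1965, §5] [cite: Rogawski1990, §1.10 p. 9] -/
theorem U3LocalBruhatDecomposition_holds (L : Type) [Field L] [NumberField L] [IsCMField L] :
    U3LocalBruhatDecomposition L := by
  intro v hns
  obtain ⟨w⟩ : Nonempty (PlacesOver L v) := inferInstance
  letI : Field (LocalRing L v) :=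
    (LocalRing.isField_of_smul_eq (IsCMField.complexConj L) (IsCMField.complexConj_ne_one L) w (hns w)).toField
  have hJ : cmLocalForm L 3 v = (StdForm.antidiagonal 3).over (LocalRing L v) := cmLocalForm_eq_over L 3 v
  refine ⟨weylLongU (conjLocal L (IsCMField.complexConj L) v) hJ, coe_coe_weylLongU _ hJ,
    weylLongU_not_mem_borelU _ hJ, mem_borelU_or_exists_eq_mul_weylLongU_mul _ hJ, ?_⟩
  intro b hb b' hb' u hu u' hu' h
  exact eq_of_mul_weylLongU_mul_eq _ hJ hb hb' hu hu' h

end CM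

end UnitaryGroup

end Literature.NumberTheory.Automorphic
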